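import Summits.Ventures.LatticeQCDFlow.TrivializingMaps.GibbsFibreVariance

/-!
HONEST FRAMING: exact (Metropolis-corrected) sampling algorithms for lattice gauge theory; figures
of merit are autocorrelation/cost numbers at stated couplings and volumes; no continuum-physics
claim.

# GibbsVarianceFloor — `Var_{e^{-tS}D/Z}(S) ≥ e^{-|t|B} ∑_{e ∈ A} E[fibre variance of f_e]` OVER ANY
# SET `A` OF NON-INTERACTING LINKS, AND `E_{e^{-tS}D/Z}[Φ] ≥ e^{-|t|B'} E_D[Φ]` FOR BLOCK-LOCAL `Φ ≥ 0`
# (lean-2 GEN-9, ours)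

Venture-side (OURS).  Cell `lqcd-flow` (pub-lqcd), unit `pub-lqcd-lean-2-g9`, 2026-08-22.  Sequel of
`GibbsFibreVariance` (the one-link step); the two abstract inequalities the `β ≠ 0` extensive variance
floor of the Wilson action is assembled from (`WilsonVarianceFloorAllCouplings`):

* §1 **`sum_fibreVariance_le`** — induction over a finite set `A` of links such that `S − f_e` is
  invariant along the `e`-fibre and `f_e` is invariant along the `e'`-fibre for `e ≠ e'` in `A` (for the
  Wilson action: no plaquette contains two links of `A`), `osc f_e ≤ B`: for every continuous `c`
  invariant along all fibres of `A`,
  `e^{-|t|B} ∑_{e∈A} ∫ e^{-tS} Var_ν[h ↦ f_e(h ·_e U)] dD ≤ ∫ (S − c)² e^{-tS} dD`;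
  **`variance_tilted_ge_sum_fibreVariance`** — with `D_t := D.tilted(−tS) = e^{-tS} D / Z`:
  `e^{-|t|B} ∑_{e∈A} E_{D_t}[Var_ν[h ↦ f_e(h ·_e U)]] ≤ Var_{D_t}(S)`.
* §2 **`integral_mul_exp_ge_block`** — if `Φ ≥ 0` is continuous and depends only on the links of a
  finite block `Λ`, and `S` changes by at most `B'` when the links of `Λ` are replaced, then
  `e^{-|t|B'} (∫ Φ dD)(∫ e^{-tS} dD) ≤ ∫ Φ e^{-tS} dD`; **`integral_tilted_ge_block`** —
  `e^{-|t|B'} E_D[Φ] ≤ E_{D_t}[Φ]`.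

NOT CLAIMED: evaluation of the fibre variances or of `B, B'` for a concrete action (the sequel);
optimal constants.  Literature grade (cell rule): known mechanism (law of total variance on a
sublattice of non-interacting sites; finite-energy comparison); new typing only.
-/

noncomputable section

open MeasureTheory ProbabilityTheory Filter Topology Set
open Literature.MathematicalPhysics.QuantumFieldTheory
open Literature.MathematicalPhysics.QuantumFieldTheory.Luscher2010

namespace Summit.Ventures.LatticeQCDFlow.TrivializingMaps

variable {d L : ℕ} [NeZero L] {G : Type*} [Group G] [TopologicalSpace G] [IsTopologicalGroup G]
  [CompactSpace G] [MeasurableSpace G] [BorelSpace G] [SecondCountableTopology G]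

/-! ## §1 Induction over non-interacting links; the variance of the tilted measure -/

section Induction

variable [DecidableEq (Edge d L)]

/-- **`e^{-|t|B} ∑_{e∈A} ∫ e^{-tS} Var_ν[h ↦ f_e(h ·_e U)] dD(U) ≤ ∫ (S − c)² e^{-tS} dD`** for every
finite set `A` of links with `S − f_e` invariant along `e` (`e ∈ A`), `f_e` invariant along `e' ≠ e`
(`e, e' ∈ A`), `osc f_e ≤ B`, and every continuous `c` invariant along all `e ∈ A` (induction on `A` by
the one-link step, re-centring at each link). [ours] -/
theorem sum_fibreVariance_le (t B : ℝ) {S : GaugeConfig d L G → ℝ} (hS : Continuous S)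
    (f : Edge d L → GaugeConfig d L G → ℝ) (hf : ∀ e, Continuous (f e))
    (hB : ∀ e U V, f e U - f e V ≤ B) (A : Finset (Edge d L))
    (hr : ∀ e ∈ A, ∀ (h : G) (U : GaugeConfig d L G),
      S (Pi.mulSingle e h * U) - f e (Pi.mulSingle e h * U) = S U - f e U)
    (hff : ∀ e ∈ A, ∀ e' ∈ A, e ≠ e' → ∀ (h : G) (U : GaugeConfig d L G),
      f e (Pi.mulSingle e' h * U) = f e U)
    {c : GaugeConfig d L G → ℝ} (hc : Continuous c)
    (hcinv : ∀ e ∈ A, ∀ (h : G) (U : GaugeConfig d L G), c (Pi.mulSingle e h * U) = c U) :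
    Real.exp (-(|t| * B)) * ∑ e ∈ A, ∫ U, Real.exp (-(t * S U)) *
        variance (fun h => f e (Pi.mulSingle e h * U)) (haarProbability G) ∂(trivialMeasure G d L) ≤
      ∫ U, (S U - c U) ^ 2 * Real.exp (-(t * S U)) ∂(trivialMeasure G d L) := by
  induction A using Finset.induction_on generalizing c with
  | empty =>
    simp only [Finset.sum_empty, mul_zero]
    exact integral_nonneg fun U => by positivity
  | insert e₀ A' he₀ ih =>
    have he₀m : e₀ ∈ insert e₀ A' := Finset.mem_insert_self e₀ A'
    have hsub : ∀ e ∈ A', e ∈ insert e₀ A' := fun e he => Finset.mem_insert_of_mem he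
    -- the one-link step at `e₀`
    have step := one_link_step (G := G) e₀ t B hS (hf e₀) hc (hr e₀ he₀m) (hcinv e₀ he₀m) (hB e₀)
    simp only at step
    -- the shifted centring `c' = f_{e₀} + c − m_{e₀}` is continuous and invariant along every `e ∈ A'`
    set m : GaugeConfig d L G → ℝ := fun U =>
      (∫ h, f e₀ (Pi.mulSingle e₀ h * U) * Real.exp (-(t * f e₀ (Pi.mulSingle e₀ h * U)))
          ∂(haarProbability G)) /
        ∫ h, Real.exp (-(t * f e₀ (Pi.mulSingle e₀ h * U))) ∂(haarProbability G) with hmdef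
    have hmc : Continuous m := continuous_fibreTiltMean e₀ t (hf e₀)
    have hne : ∀ e ∈ A', e ≠ e₀ := fun e he h => he₀ (h ▸ he)
    have hc'inv : ∀ e ∈ A', ∀ (h : G) (U : GaugeConfig d L G),
        f e₀ (Pi.mulSingle e h * U) + c (Pi.mulSingle e h * U) - m (Pi.mulSingle e h * U) =
          f e₀ U + c U - m U := by
      intro e he h U
      have hfinv : ∀ (k : G) (V : GaugeConfig d L G), f e₀ (Pi.mulSingle e k * V) = f e₀ V :=
        hff e₀ he₀m e (hsub e he) (hne e he).symm
      rw [hfinv, hcinv e (hsub e he)]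
      simp only [hmdef]
      rw [fibreTiltMean_invariant (hne e he) t hfinv h U]
    have ih' := ih (fun e he => hr e (hsub e he))
      (fun e he e' he' hne' => hff e (hsub e he) e' (hsub e' he') hne')
      (c := fun U => f e₀ U + c U - m U) (((hf e₀).add hc).sub hmc) hc'inv
    rw [Finset.sum_insert he₀, mul_add]
    linarith [step, ih']

omit [SecondCountableTopology G] [DecidableEq (Edge d L)] in
/-- The tilted measure `D_t = D.tilted(−tS)`: `∫ g dD_t = (∫ e^{-tS} g dD) / ∫ e^{-tS} dD`. [folklore] -/
theorem integral_tilted_neg_mul (t : ℝ) (S g : GaugeConfig d L G → ℝ) :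
    ∫ U, g U ∂((trivialMeasure G d L).tilted fun U => -(t * S U)) =
      (∫ U, Real.exp (-(t * S U)) * g U ∂(trivialMeasure G d L)) /
        ∫ U, Real.exp (-(t * S U)) ∂(trivialMeasure G d L) := by
  rw [integral_tilted]
  simp only [smul_eq_mul]
  have : ∀ U, Real.exp (-(t * S U)) / (∫ V, Real.exp (-(t * S V)) ∂(trivialMeasure G d L)) * g U =
      (Real.exp (-(t * S U)) * g U) / ∫ V, Real.exp (-(t * S V)) ∂(trivialMeasure G d L) :=
    fun U => by ring
  simp_rw [this]
  rw [integral_div]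

/-- **THE VARIANCE OF THE TILTED MEASURE DOMINATES THE SUMMED FIBRE VARIANCES.**  With
`D_t = D.tilted(−tS) = e^{-tS} D[U] / Z` and `A`, `f`, `B` as in `sum_fibreVariance_le`:
`e^{-|t|B} ∑_{e∈A} E_{D_t}[ Var_ν[h ↦ f_e(h ·_e U)] ] ≤ Var_{D_t}(S)`. [ours] -/
theorem variance_tilted_ge_sum_fibreVariance (t B : ℝ) {S : GaugeConfig d L G → ℝ} (hS : Continuous S)
    (f : Edge d L → GaugeConfig d L G → ℝ) (hf : ∀ e, Continuous (f e))
    (hB : ∀ e U V, f e U - f e V ≤ B) (A : Finset (Edge d L))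
    (hr : ∀ e ∈ A, ∀ (h : G) (U : GaugeConfig d L G),
      S (Pi.mulSingle e h * U) - f e (Pi.mulSingle e h * U) = S U - f e U)
    (hff : ∀ e ∈ A, ∀ e' ∈ A, e ≠ e' → ∀ (h : G) (U : GaugeConfig d L G),
      f e (Pi.mulSingle e' h * U) = f e U) :
    Real.exp (-(|t| * B)) * ∑ e ∈ A, ∫ U, variance (fun h => f e (Pi.mulSingle e h * U)) (haarProbability G)
        ∂((trivialMeasure G d L).tilted fun U => -(t * S U)) ≤
      variance S ((trivialMeasure G d L).tilted fun U => -(t * S U)) := by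
  set D := trivialMeasure G d L with hD
  set Dt := D.tilted fun U => -(t * S U) with hDt
  haveI : IsProbabilityMeasure D := trivialMeasure_isProbabilityMeasure
  have hZpos : 0 < ∫ U, Real.exp (-(t * S U)) ∂D :=
    integral_exp_pos ((BoundedContinuousFunction.mkOfCompact ⟨fun U => Real.exp (-(t * S U)), by fun_prop⟩).integrable _)
  haveI : IsProbabilityMeasure Dt :=
    isProbabilityMeasure_tilted ((BoundedContinuousFunction.mkOfCompact
      ⟨fun U => Real.exp (-(t * S U)), by fun_prop⟩).integrable _)
  set M : ℝ := ∫ U, S U ∂Dt with hM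
  -- the variance of `D_t` as a `D`-integral
  have hvar : variance S Dt = (∫ U, Real.exp (-(t * S U)) * (S U - M) ^ 2 ∂D) /
      ∫ U, Real.exp (-(t * S U)) ∂D := by
    rw [variance_eq_integral hS.aemeasurable, ← hM, hDt, integral_tilted_neg_mul]
  -- the fibre-variance expectations as `D`-integrals
  have hfib : ∀ e, ∫ U, variance (fun h => f e (Pi.mulSingle e h * U)) (haarProbability G) ∂Dt =
      (∫ U, Real.exp (-(t * S U)) * variance (fun h => f e (Pi.mulSingle e h * U)) (haarProbability G) ∂D) /
        ∫ U, Real.exp (-(t * S U)) ∂D := fun e => by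
    rw [hDt, integral_tilted_neg_mul]
  have key := sum_fibreVariance_le (G := G) t B hS f hf hB A hr hff (c := fun _ => M) continuous_const
    (fun _ _ _ _ => rfl)
  have hcomm : ∫ U, (S U - M) ^ 2 * Real.exp (-(t * S U)) ∂D =
      ∫ U, Real.exp (-(t * S U)) * (S U - M) ^ 2 ∂D :=
    integral_congr_ae (ae_of_all _ fun U => mul_comm _ _)
  rw [hvar]
  simp_rw [hfib]
  rw [← Finset.sum_div, ← mul_div_assoc]
  refine div_le_div_of_nonneg_right ?_ hZpos.le
  rw [← hcomm]
  exact key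

end Induction

/-! ## §2 Block comparison: tilted expectation of a block-local function against `D[U]` -/

section Block

/-- **`e^{-|t|B'} (∫ Φ dD)(∫ e^{-tS} dD) ≤ ∫ Φ e^{-tS} dD`** for `Φ ≥ 0` continuous depending only on the
links of a finite block `Λ` and `S` continuous with `S(k ·_Λ U) − S(k' ·_Λ U) ≤ B'` for all `k, k', U`
(`k ·_Λ U := (Λ.piecewise k 1) · U` replaces the links of `Λ`). [ours] -/
theorem integral_mul_exp_ge_block (Λ : Finset (Edge d L)) (t B' : ℝ) {S Φ : GaugeConfig d L G → ℝ}
    (hS : Continuous S) (hΦ : Continuous Φ) (hΦnn : ∀ U, 0 ≤ Φ U)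
    (hdep : ∀ U V : GaugeConfig d L G, (∀ e ∈ Λ, U e = V e) → Φ U = Φ V)
    (hB' : ∀ k k' U : GaugeConfig d L G, S (Λ.piecewise k 1 * U) - S (Λ.piecewise k' 1 * U) ≤ B') :
    Real.exp (-(|t| * B')) * (∫ U, Φ U ∂(trivialMeasure G d L)) *
        (∫ U, Real.exp (-(t * S U)) ∂(trivialMeasure G d L)) ≤
      ∫ U, Φ U * Real.exp (-(t * S U)) ∂(trivialMeasure G d L) := by
  set D := trivialMeasure G d L with hD
  haveI : IsProbabilityMeasure D := trivialMeasure_isProbabilityMeasure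
  haveI : D.IsMulRightInvariant := trivialMeasure_isMulRightInvariant
  have hpw : Continuous fun q : GaugeConfig d L G × GaugeConfig d L G => Λ.piecewise q.2 1 * q.1 :=
    (continuous_piecewise_mul Λ).comp (continuous_snd.prodMk continuous_fst)
  -- block averages of `Φ e^{-tS}` and of `e^{-tS}`
  have hL := integral_eq_integral_block (G := G) Λ (Φ := fun U => Φ U * Real.exp (-(t * S U))) (by fun_prop)
  have hZ := integral_eq_integral_block (G := G) Λ (Φ := fun U => Real.exp (-(t * S U))) (by fun_prop)
  set Zb : GaugeConfig d L G → ℝ := fun U => ∫ k, Real.exp (-(t * S (Λ.piecewise k 1 * U))) ∂D with hZb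
  -- (i) the block average of `Φ` is `∫ Φ dD` (locality + right invariance)
  have hΦloc : ∀ k U : GaugeConfig d L G, Φ (Λ.piecewise k 1 * U) = Φ (k * U) := fun k U =>
    hdep _ _ fun e he => by simp only [Pi.mul_apply, Finset.piecewise_eq_of_mem _ _ _ he]
  have hΦavg : ∀ U, ∫ k, Φ (Λ.piecewise k 1 * U) ∂D = ∫ k, Φ k ∂D := fun U => by
    simp only [hΦloc]
    exact integral_mul_right_eq_self (μ := D) Φ U
  -- (ii) domination of the weight by its block average
  have hdom : ∀ k U : GaugeConfig d L G,
      Real.exp (-(|t| * B')) * Zb U ≤ Real.exp (-(t * S (Λ.piecewise k 1 * U))) := fun k U =>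
    exp_neg_mul_ge_exp_mul_integral D (g := fun k => S (Λ.piecewise k 1 * U)) (fun y y' => hB' y y' U) k
  -- (iii) the inner inequality, pointwise in `U`
  have hZbc : Continuous Zb := continuous_integral_param D
    (F := fun U k => Real.exp (-(t * S (Λ.piecewise k 1 * U)))) (by
      show Continuous fun q : GaugeConfig d L G × GaugeConfig d L G =>
        Real.exp (-(t * S (Λ.piecewise q.2 1 * q.1)))
      exact Real.continuous_exp.comp ((continuous_const.mul (hS.comp hpw)).neg))
  have hinc : Continuous fun U => ∫ k, Φ (Λ.piecewise k 1 * U) * Real.exp (-(t * S (Λ.piecewise k 1 * U))) ∂D :=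
    continuous_integral_param D
      (F := fun U k => Φ (Λ.piecewise k 1 * U) * Real.exp (-(t * S (Λ.piecewise k 1 * U)))) (by
      show Continuous fun q : GaugeConfig d L G × GaugeConfig d L G =>
        Φ (Λ.piecewise q.2 1 * q.1) * Real.exp (-(t * S (Λ.piecewise q.2 1 * q.1)))
      exact (hΦ.comp hpw).mul (Real.continuous_exp.comp ((continuous_const.mul (hS.comp hpw)).neg)))
  have hint : ∀ {g : GaugeConfig d L G → ℝ}, Continuous g → Integrable g D := fun hg =>
    (BoundedContinuousFunction.mkOfCompact ⟨_, hg⟩).integrable _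
  have hinner : ∀ U, Real.exp (-(|t| * B')) * (∫ k, Φ k ∂D) * Zb U ≤
      ∫ k, Φ (Λ.piecewise k 1 * U) * Real.exp (-(t * S (Λ.piecewise k 1 * U))) ∂D := by
    intro U
    have hΦkc : Continuous fun k : GaugeConfig d L G => Φ (Λ.piecewise k 1 * U) :=
      hΦ.comp ((continuous_piecewise_mul Λ).comp (continuous_id.prodMk continuous_const))
    have hSkc : Continuous fun k : GaugeConfig d L G => Real.exp (-(t * S (Λ.piecewise k 1 * U))) :=
      Real.continuous_exp.comp ((continuous_const.mul
        (hS.comp ((continuous_piecewise_mul Λ).comp (continuous_id.prodMk continuous_const)))).neg)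
    calc Real.exp (-(|t| * B')) * (∫ k, Φ k ∂D) * Zb U
        = ∫ k, Φ (Λ.piecewise k 1 * U) * (Real.exp (-(|t| * B')) * Zb U) ∂D := by
          rw [integral_mul_const, hΦavg U]; ring
      _ ≤ ∫ k, Φ (Λ.piecewise k 1 * U) * Real.exp (-(t * S (Λ.piecewise k 1 * U))) ∂D :=
          integral_mono (hint (hΦkc.mul continuous_const)) (hint (hΦkc.mul hSkc)) fun k =>
            mul_le_mul_of_nonneg_left (hdom k U) (hΦnn _)
  -- (iv) integrate over `U`
  calc Real.exp (-(|t| * B')) * (∫ U, Φ U ∂D) * ∫ U, Real.exp (-(t * S U)) ∂D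
      = ∫ U, Real.exp (-(|t| * B')) * (∫ k, Φ k ∂D) * Zb U ∂D := by
        rw [hZ, integral_const_mul]
    _ ≤ ∫ U, ∫ k, Φ (Λ.piecewise k 1 * U) * Real.exp (-(t * S (Λ.piecewise k 1 * U))) ∂D ∂D :=
        integral_mono (hint (continuous_const.mul hZbc)) (hint hinc) hinner
    _ = ∫ U, Φ U * Real.exp (-(t * S U)) ∂D := hL.symm

/-- **`e^{-|t|B'} E_D[Φ] ≤ E_{D_t}[Φ]`**, `D_t = D.tilted(−tS)`, for block-local `Φ ≥ 0` as in
`integral_mul_exp_ge_block`: a Gibbs expectation of a local non-negative observable is comparable to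
its `β = 0` value at the cost of the LOCAL energy only. [ours] -/
theorem integral_tilted_ge_block (Λ : Finset (Edge d L)) (t B' : ℝ) {S Φ : GaugeConfig d L G → ℝ}
    (hS : Continuous S) (hΦ : Continuous Φ) (hΦnn : ∀ U, 0 ≤ Φ U)
    (hdep : ∀ U V : GaugeConfig d L G, (∀ e ∈ Λ, U e = V e) → Φ U = Φ V)
    (hB' : ∀ k k' U : GaugeConfig d L G, S (Λ.piecewise k 1 * U) - S (Λ.piecewise k' 1 * U) ≤ B') :
    Real.exp (-(|t| * B')) * ∫ U, Φ U ∂(trivialMeasure G d L) ≤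
      ∫ U, Φ U ∂((trivialMeasure G d L).tilted fun U => -(t * S U)) := by
  haveI : IsProbabilityMeasure (trivialMeasure G d L) := trivialMeasure_isProbabilityMeasure
  have hZpos : 0 < ∫ U, Real.exp (-(t * S U)) ∂(trivialMeasure G d L) :=
    integral_exp_pos ((BoundedContinuousFunction.mkOfCompact
      ⟨fun U => Real.exp (-(t * S U)), by fun_prop⟩).integrable _)
  have h := integral_mul_exp_ge_block (G := G) Λ t B' hS hΦ hΦnn hdep hB'
  rw [integral_tilted_neg_mul, le_div_iff₀ hZpos]
  have hcomm : ∫ U, Real.exp (-(t * S U)) * Φ U ∂(trivialMeasure G d L) =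
      ∫ U, Φ U * Real.exp (-(t * S U)) ∂(trivialMeasure G d L) :=
    integral_congr_ae (ae_of_all _ fun U => mul_comm _ _)
  rw [hcomm]
  exact h

end Block

end Summit.Ventures.LatticeQCDFlow.TrivializingMaps
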